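import Literature.NumberTheory.EllipticCurves.NeronModelAbelianScheme
import Literature.AlgebraicGeometry.Resolution.AlterationsLemma32
import Literature.AlgebraicGeometry.Resolution.PrincipalizationToResolution
import Mathlib.AlgebraicGeometry.PullbackCarrier
import HarnessLib

/-!
# Abelian schemes are Néron models: the extension problem is local on the source; reduction to
# integral sources

Infrastructure towards the named fact
`Literature.NumberTheory.EllipticCurves.isNeronModel_of_abelianScheme` (Artin, *Néron Models*,
Cor. (1.4)), continuing `NeronModelAbelianScheme`, `NeronModelAtPrimes`, `NeronModelExtensionSetup`:
there the fact is reduced to the extension of `R`-morphisms `g : U → 𝒜` defined on an open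
subscheme `U ⊆ X` containing the generic fibre of a smooth `R`-scheme `𝒳` (total space `X`,
affine) to all of `X`, `R` a discrete valuation ring. This file reduces further to the case of an
**integral** (affine, smooth) source, the setting of Artin's (1.1) and of Weil's extension
theorem (Artin, Prop. (1.3); Liu, *Algebraic Geometry and Arithmetic Curves*, Thm. 10.2.15), in
which rational maps and function fields are available:

* `hom_ext_of_ι_comp_eq` — uniqueness: two `R`-morphisms from a flat `R`-scheme to a separated
  `R`-scheme which agree on an open subscheme containing the generic fibre are equal (the
  generic fibre is schematically dense, `NeronModelAbelianScheme`);
* `openExtension_of_openCover` — **the extension property is local on the source**: if the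
  members of an open cover of `X` have it, so does `X` (extend on each member, the extensions
  agree on overlaps by uniqueness, glue with Mathlib's `Scheme.Cover.glueMorphisms`);
* `isAffineOpen_of_isClopen` — an open and closed subset of an affine scheme is an affine open
  (it is a basic open `D(e)`, `e` idempotent; Mathlib
  `PrimeSpectrum.exists_idempotent_basicOpen_eq_of_isClopen`);
* `openExtension_of_forall_isIntegral` — **reduction to integral sources**: a smooth scheme `X`
  over a discrete valuation ring is regular (EGA IV₄ 17.5.8 (iii),
  `Literature.AlgebraicGeometry.Resolution.Scheme.IsRegular.of_smooth`), so its irreducible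
  components are pairwise disjoint, open and closed
  (`Literature.AlgebraicGeometry.Resolution.Scheme.IsRegular.coe_irreducibleComponentOpen`), and
  they form an open cover of `X` by integral affine smooth `R`-schemes.

No named facts are introduced (D-0026); everything here is proved.

## References

* M. Artin, *Néron Models*, in Cornell–Silverman (eds.), *Arithmetic Geometry*, Springer 1986,
  (1.1), Prop. (1.3), Cor. (1.4) (pp. 213–215). [Artin1986NeronModels]
* A. Grothendieck, EGA IV₄ (Publ. Math. IHÉS 32, 1967), Prop. 17.5.8 (iii). [Grothendieck1967]
* The Stacks project, Tag 0357 (irreducible components of a normal scheme are disjoint).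
  [StacksProject]
-/

noncomputable section

universe u

namespace Literature.NumberTheory.EllipticCurves

open _root_.AlgebraicGeometry CategoryTheory Limits TopologicalSpace

/-! ### Uniqueness: agreement on an open containing the generic fibre -/

section HomExt

variable (R : Type u) [CommRing R] (K : Type u) [Field K] [Algebra R K] [IsFractionRing R K]

/-- Two `R`-morphisms `a, b : 𝒲 → 𝒩` from a flat `R`-scheme to a separated `R`-scheme, `R` a ring
with field of fractions `K`, which agree on an open subscheme `U ⊆ 𝒲` containing the generic
fibre `𝒲_K`, are equal: the schematically dense `𝒲_K → 𝒲`
(`isSchemeTheoreticallyDominant_pullback_fst_specGenericPoint`) factors through `U`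
(Artin, *Néron Models*, (1.1): rational maps to a Néron model extend *uniquely*).
[cite: Artin1986NeronModels, §1, (1.1)] -/
theorem hom_ext_of_ι_comp_eq (𝒩 𝒲 : Over (Spec (.of R))) [IsSeparated 𝒩.hom] [Flat 𝒲.hom]
    (U : 𝒲.left.Opens)
    (hU : 𝒲.hom.base ⁻¹' Set.range (specGenericPoint R K).base ⊆ (U : Set 𝒲.left))
    {a b : 𝒲.left ⟶ 𝒩.left} (ha : a ≫ 𝒩.hom = 𝒲.hom) (hb : b ≫ 𝒩.hom = 𝒲.hom)
    (h : U.ι ≫ a = U.ι ≫ b) : a = b := by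
  have hrange : Set.range (pullback.fst 𝒲.hom (specGenericPoint R K)).base ⊆
      Set.range U.ι.base := by
    rw [Scheme.Opens.range_ι, Scheme.Pullback.range_fst]
    exact hU
  have hl : IsOpenImmersion.lift U.ι (pullback.fst 𝒲.hom (specGenericPoint R K)) hrange ≫ U.ι =
      pullback.fst 𝒲.hom (specGenericPoint R K) := IsOpenImmersion.lift_fac _ _ _
  haveI := isSchemeTheoreticallyDominant_pullback_fst_specGenericPoint R K 𝒲
  refine Literature.AlgebraicGeometry.Resolution.ext_of_isSchemeTheoreticallyDominant_of_isSeparated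
    𝒩.hom (ha.trans hb.symm) (pullback.fst 𝒲.hom (specGenericPoint R K)) ?_
  rw [← hl, Category.assoc, h, Category.assoc]

end HomExt

/-! ### The extension property is local on the source -/

section LocalOnSource

variable (R : Type u) [CommRing R] (K : Type u) [Field K] [Algebra R K] [IsFractionRing R K]

/-- A morphism into `X` with image inside the open `U` factors through `U` (Mathlib
`IsOpenImmersion.lift`). [folklore] -/
theorem exists_lift_opens {X T : Scheme.{u}} (U : X.Opens) (t : T ⟶ X)
    (ht : Set.range t.base ⊆ (U : Set X)) : ∃ t' : T ⟶ U, t' ≫ U.ι = t :=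
  ⟨IsOpenImmersion.lift U.ι t (by rwa [Scheme.Opens.range_ι]), IsOpenImmersion.lift_fac _ _ _⟩

/-- **The extension property for morphisms from opens containing the generic fibre is local on
the source.** Let `R` be a ring with field of fractions `K`, `𝒜 → Spec R` separated,
`𝒳 → Spec R` flat, and `𝒱` an open cover of the total space `X` of `𝒳`. Suppose that for every
member `Vᵢ` of the cover, every `R`-morphism `Uᵢ → 𝒜` from an open `Uᵢ ⊆ Vᵢ` containing the
generic fibre of `Vᵢ` extends to an `R`-morphism `Vᵢ → 𝒜`. Then every `R`-morphism `g : U → 𝒜` from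
an open `U ⊆ X` containing the generic fibre of `𝒳` extends to an `R`-morphism `X → 𝒜`: extend
the restrictions `g|_{U ∩ Vᵢ}`; the extensions agree on `Vᵢ ∩ Vⱼ` because they agree on the open
`U ∩ Vᵢ ∩ Vⱼ`, which contains the generic fibre (`hom_ext_of_ι_comp_eq`); glue
(`Scheme.Cover.glueMorphisms`). [folklore] -/
theorem openExtension_of_openCover (𝒜 𝒳 : Over (Spec (.of R))) [IsSeparated 𝒜.hom]
    [Flat 𝒳.hom] (𝒱 : 𝒳.left.OpenCover)
    (H : ∀ (i : 𝒱.I₀) (U : (𝒱.X i).Opens),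
      (𝒱.f i ≫ 𝒳.hom).base ⁻¹' Set.range (specGenericPoint R K).base ⊆ (U : Set (𝒱.X i)) →
      ∀ g : (U : Scheme.{u}) ⟶ 𝒜.left, g ≫ 𝒜.hom = U.ι ≫ 𝒱.f i ≫ 𝒳.hom →
        ∃ f : 𝒱.X i ⟶ 𝒜.left, f ≫ 𝒜.hom = 𝒱.f i ≫ 𝒳.hom ∧ U.ι ≫ f = g)
    (U : 𝒳.left.Opens)
    (hU : 𝒳.hom.base ⁻¹' Set.range (specGenericPoint R K).base ⊆ (U : Set 𝒳.left))
    (g : (U : Scheme.{u}) ⟶ 𝒜.left) (hg : g ≫ 𝒜.hom = U.ι ≫ 𝒳.hom) :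
    ∃ f : 𝒳.left ⟶ 𝒜.left, f ≫ 𝒜.hom = 𝒳.hom ∧ U.ι ≫ f = g := by
  -- the restrictions `gᵢ : Uᵢ = U ∩ Vᵢ → 𝒜`
  let Ui : ∀ i, (𝒱.X i).Opens := fun i => (𝒱.f i) ⁻¹ᵁ U
  have hUi_range : ∀ i, Set.range ((Ui i).ι ≫ 𝒱.f i).base ⊆ (U : Set 𝒳.left) := by
    rintro i _ ⟨y, rfl⟩
    exact y.2
  choose r hr using fun i => exists_lift_opens U ((Ui i).ι ≫ 𝒱.f i) (hUi_range i)
  have hUi : ∀ i, (𝒱.f i ≫ 𝒳.hom).base ⁻¹' Set.range (specGenericPoint R K).base ⊆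
      (Ui i : Set (𝒱.X i)) := fun i y hy => hU hy
  have hgi : ∀ i, (r i ≫ g) ≫ 𝒜.hom = (Ui i).ι ≫ 𝒱.f i ≫ 𝒳.hom := by
    intro i
    rw [Category.assoc, hg, ← Category.assoc, hr, Category.assoc]
  choose f hf hfU using fun i => H i (Ui i) (hUi i) (r i ≫ g) (hgi i)
  -- a restriction lemma: for `t : T → Vᵢ` landing in `Uᵢ`, `t ≫ fᵢ = (lift of t ≫ 𝒱.f i to U) ≫ g`
  have hres : ∀ (i : 𝒱.I₀) {T : Scheme.{u}} (t : T ⟶ 𝒱.X i) (t' : T ⟶ U),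
      Set.range t.base ⊆ (Ui i : Set (𝒱.X i)) → t' ≫ U.ι = t ≫ 𝒱.f i → t ≫ f i = t' ≫ g := by
    intro i T t t' ht ht'
    obtain ⟨s, hs⟩ := exists_lift_opens (Ui i) t ht
    have hst : s ≫ r i = t' := by
      rw [← cancel_mono U.ι, Category.assoc, hr, ← Category.assoc, hs, ht']
    rw [← hs, Category.assoc, hfU, ← Category.assoc, hst]
  -- compatibility on overlaps
  have hcompat : ∀ i j, pullback.fst (𝒱.f i) (𝒱.f j) ≫ f i =
      pullback.snd (𝒱.f i) (𝒱.f j) ≫ f j := by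
    intro i j
    let 𝒲 : Over (Spec (.of R)) := Over.mk ((pullback.fst (𝒱.f i) (𝒱.f j) ≫ 𝒱.f i) ≫ 𝒳.hom)
    let p₁ : 𝒲.left ⟶ 𝒱.X i := pullback.fst (𝒱.f i) (𝒱.f j)
    let p₂ : 𝒲.left ⟶ 𝒱.X j := pullback.snd (𝒱.f i) (𝒱.f j)
    have hp : p₁ ≫ 𝒱.f i = p₂ ≫ 𝒱.f j := pullback.condition
    change p₁ ≫ f i = p₂ ≫ f j
    haveI : Flat 𝒲.hom := by
      change Flat ((pullback.fst (𝒱.f i) (𝒱.f j) ≫ 𝒱.f i) ≫ 𝒳.hom)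
      infer_instance
    let W : 𝒲.left.Opens := (p₁ ≫ 𝒱.f i) ⁻¹ᵁ U
    have hW : 𝒲.hom.base ⁻¹' Set.range (specGenericPoint R K).base ⊆ (W : Set 𝒲.left) :=
      fun y hy => hU hy
    have hcond : ∀ y : 𝒲.left, (p₁ ≫ 𝒱.f i).base y = (p₂ ≫ 𝒱.f j).base y := fun y => by
      rw [hp]
    obtain ⟨w, hw⟩ := exists_lift_opens U (W.ι ≫ p₁ ≫ 𝒱.f i) (by
      rintro _ ⟨y, rfl⟩
      exact y.2)
    have e1 : (W.ι ≫ p₁) ≫ f i = w ≫ g :=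
      hres i (W.ι ≫ p₁) w (by
        rintro _ ⟨y, rfl⟩
        exact y.2) (by rw [hw, Category.assoc])
    have e2 : (W.ι ≫ p₂) ≫ f j = w ≫ g :=
      hres j (W.ι ≫ p₂) w (by
        rintro _ ⟨y, rfl⟩
        change (p₂ ≫ 𝒱.f j).base y.1 ∈ (U : Set 𝒳.left)
        rw [← hcond]
        exact y.2) (by rw [hw, Category.assoc, hp])
    refine hom_ext_of_ι_comp_eq R K 𝒜 𝒲 W hW (a := p₁ ≫ f i) (b := p₂ ≫ f j) ?_ ?_ ?_
    · change (p₁ ≫ f i) ≫ 𝒜.hom = (p₁ ≫ 𝒱.f i) ≫ 𝒳.hom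
      rw [Category.assoc, hf, Category.assoc]
    · change (p₂ ≫ f j) ≫ 𝒜.hom = (p₁ ≫ 𝒱.f i) ≫ 𝒳.hom
      rw [Category.assoc, hf, hp, Category.assoc]
    · calc W.ι ≫ p₁ ≫ f i = (W.ι ≫ p₁) ≫ f i := (Category.assoc _ _ _).symm
        _ = w ≫ g := e1
        _ = (W.ι ≫ p₂) ≫ f j := e2.symm
        _ = W.ι ≫ p₂ ≫ f j := Category.assoc _ _ _
  -- glue
  let gl : 𝒳.left ⟶ 𝒜.left := Scheme.Cover.glueMorphisms 𝒱 f hcompat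
  have hgl : ∀ i, 𝒱.f i ≫ gl = f i := fun i => Scheme.Cover.ι_glueMorphisms 𝒱 f hcompat i
  refine ⟨gl, ?_, ?_⟩
  · refine Scheme.Cover.hom_ext 𝒱 _ _ fun i => ?_
    rw [← Category.assoc, hgl, hf]
  · refine Scheme.Cover.hom_ext (𝒱.pullback₁ U.ι) _ _ fun i => ?_
    change pullback.fst U.ι (𝒱.f i) ≫ U.ι ≫ gl = pullback.fst U.ι (𝒱.f i) ≫ g
    rw [← Category.assoc, pullback.condition, Category.assoc, hgl]
    refine hres i (pullback.snd U.ι (𝒱.f i)) (pullback.fst U.ι (𝒱.f i)) ?_ pullback.condition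
    rintro _ ⟨y, rfl⟩
    change (𝒱.f i).base ((pullback.snd U.ι (𝒱.f i)).base y) ∈ (U : Set 𝒳.left)
    have e : ((pullback.snd U.ι (𝒱.f i)) ≫ 𝒱.f i).base y =
        ((pullback.fst U.ι (𝒱.f i)) ≫ U.ι).base y := by rw [pullback.condition]
    change ((pullback.snd U.ι (𝒱.f i)) ≫ 𝒱.f i).base y ∈ (U : Set 𝒳.left)
    rw [e]
    exact ((pullback.fst U.ι (𝒱.f i)).base y).2

end LocalOnSource

/-! ### Open-and-closed subsets of affine schemes; reduction to integral sources -/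

section Integral

/-- An open and closed subset of an affine scheme is an affine open subscheme: transported to
`Spec Γ(X, 𝒪_X)` it is a basic open `D(e)` for an idempotent `e` (Mathlib
`PrimeSpectrum.exists_idempotent_basicOpen_eq_of_isClopen`). [folklore] -/
theorem isAffineOpen_of_isClopen {X : Scheme.{u}} [IsAffine X] (U : X.Opens)
    (hU : IsClopen (U : Set X)) : IsAffineOpen U := by
  have hU' : IsClopen ((X.isoSpec.inv ⁻¹ᵁ U : (Spec Γ(X, ⊤)).Opens) : Set (Spec Γ(X, ⊤))) :=
    hU.preimage X.isoSpec.inv.continuous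
  obtain ⟨s, -, hs⟩ := PrimeSpectrum.exists_idempotent_basicOpen_eq_of_isClopen hU'
  have h1 : IsAffineOpen (X.isoSpec.inv ⁻¹ᵁ U) := by
    have e : X.isoSpec.inv ⁻¹ᵁ U = PrimeSpectrum.basicOpen s := Opens.ext hs
    rw [e, ← basicOpen_eq_of_affine]
    exact (isAffineOpen_top _).basicOpen _
  have h2 : X.isoSpec.hom ⁻¹ᵁ (X.isoSpec.inv ⁻¹ᵁ U) = U := by
    rw [← Scheme.Hom.comp_preimage, Iso.hom_inv_id]
    rfl
  rw [← h2]
  exact h1.preimage_of_isIso X.isoSpec.hom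

variable (R : Type u) [CommRing R] [IsDomain R] [IsDiscreteValuationRing R] (K : Type u) [Field K]
  [Algebra R K] [IsFractionRing R K]

/-- **Reduction of the extension problem to integral sources.** Let `R` be a discrete valuation
ring with fraction field `K` and `𝒜 → Spec R` separated. If for every smooth `R`-scheme `𝒴` with
*integral affine* total space, every `R`-morphism `U → 𝒜` from an open `U` containing the generic
fibre extends to `𝒴 → 𝒜`, then the same holds for every smooth `R`-scheme `𝒳` with affine total
space `X`. Indeed `X` is a Noetherian regular scheme (smooth over the regular scheme `Spec R`,
EGA IV₄ 17.5.8 (iii)), so its finitely many irreducible components are pairwise disjoint, open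
and closed, hence integral affine open subschemes covering `X`, and the extension property is
local on the source (`openExtension_of_openCover`). [cite: Grothendieck1967, Prop. 17.5.8 (iii) (PDF p. 69)] -/
theorem openExtension_of_forall_isIntegral (𝒜 : Over (Spec (.of R))) [IsSeparated 𝒜.hom]
    (H : ∀ 𝒴 : Over (Spec (.of R)), Smooth 𝒴.hom → IsAffine 𝒴.left → IsIntegral 𝒴.left →
      ∀ U : 𝒴.left.Opens,
        𝒴.hom.base ⁻¹' Set.range (specGenericPoint R K).base ⊆ (U : Set 𝒴.left) →
        ∀ g : (U : Scheme.{u}) ⟶ 𝒜.left, g ≫ 𝒜.hom = U.ι ≫ 𝒴.hom →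
          ∃ f : 𝒴.left ⟶ 𝒜.left, f ≫ 𝒜.hom = 𝒴.hom ∧ U.ι ≫ f = g)
    (𝒳 : Over (Spec (.of R))) (h𝒳 : Smooth 𝒳.hom) (h𝒳a : IsAffine 𝒳.left)
    (U : 𝒳.left.Opens)
    (hU : 𝒳.hom.base ⁻¹' Set.range (specGenericPoint R K).base ⊆ (U : Set 𝒳.left))
    (g : (U : Scheme.{u}) ⟶ 𝒜.left) (hg : g ≫ 𝒜.hom = U.ι ≫ 𝒳.hom) :
    ∃ f : 𝒳.left ⟶ 𝒜.left, f ≫ 𝒜.hom = 𝒳.hom ∧ U.ι ≫ f = g := by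
  haveI := h𝒳
  haveI := h𝒳a
  haveI : IsLocallyNoetherian 𝒳.left := LocallyOfFiniteType.isLocallyNoetherian 𝒳.hom
  haveI : IsNoetherian 𝒳.left := {}
  have hreg : Literature.AlgebraicGeometry.Resolution.Scheme.IsRegular 𝒳.left :=
    Literature.AlgebraicGeometry.Resolution.Scheme.IsRegular.of_smooth 𝒳.hom
      (Literature.AlgebraicGeometry.Resolution.Scheme.isRegular_Spec (.of R))
  haveI : IsReduced 𝒳.left := hreg.isReduced
  -- the open cover by the irreducible components
  let J : Set (Set 𝒳.left) := irreducibleComponents 𝒳.left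
  let V : J → 𝒳.left.Opens := fun C => 𝒳.left.irreducibleComponentOpen C.1
  have hV : ∀ C : J, (V C : Set 𝒳.left) = C.1 := fun C => hreg.coe_irreducibleComponentOpen C.2
  let 𝒱 : 𝒳.left.OpenCover :=
    Scheme.Cover.mkOfCovers J (fun C => (V C : Scheme.{u})) (fun C => (V C).ι) (fun x =>
      ⟨⟨irreducibleComponent x, irreducibleComponent_mem_irreducibleComponents x⟩,
        ⟨x, show x ∈ (V _ : Set 𝒳.left) by
          rw [hV]
          exact mem_irreducibleComponent⟩, rfl⟩)
  refine openExtension_of_openCover R K 𝒜 𝒳 𝒱 (fun C => ?_) U hU g hg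
  -- each component is an integral affine smooth `R`-scheme
  have hirr : IsIrreducible (V C : Set 𝒳.left) := by
    rw [hV]
    exact C.2.1
  haveI : IrreducibleSpace (V C : Scheme.{u}) := Subtype.irreducibleSpace hirr
  have hint : IsIntegral (V C : Scheme.{u}) := isIntegral_of_irreducibleSpace_of_isReduced _
  have hclopen : IsClopen (V C : Set 𝒳.left) :=
    ⟨by rw [hV]; exact isClosed_of_mem_irreducibleComponents _ C.2, (V C).2⟩
  have haff : IsAffine (V C : Scheme.{u}) := isAffineOpen_of_isClopen (V C) hclopen
  have hsm : Smooth ((V C).ι ≫ 𝒳.hom) := inferInstance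
  exact H (Over.mk ((V C).ι ≫ 𝒳.hom)) hsm haff hint

end Integral

end Literature.NumberTheory.EllipticCurves

end
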